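import Literature.Probability.Percolation.QuadCrossingContinuityReduction
import Literature.Probability.Percolation.QuadCrossingQuadTopology
import Literature.Probability.Percolation.QuadCrossingPathCrossings
import Literature.Probability.Percolation.OpenPathAnnulusCrossing
import HarnessLib

/-!
# A crossing of the inner quad passes near every transversal: the a-priori arm of case (2)

Topic `Probability/Percolation`; proofs file towards Schramm–Smirnov's continuity Lemma 6.1
(`SchrammSmirnov2011_lemma_6_1`, file `QuadCrossingContinuity.lean`; O. Schramm, S. Smirnov, *On the
scaling limits of planar percolation*, Ann. Probab. 39 (2011), arXiv:1101.5820, §6).  In case (2)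
of the printed proof (p. 22) the crossing probability of the inner quad `Q'` is first bounded a
priori: "Let `x` be some point on the path `τ` of diameter `d₁`, connecting `∂₁Q` to `∂₃Q`.  Any
crossing of `Q'` has diameter at least `d₀ - δ` and passes within distance `δ` of `τ`, so in
particular it crosses an annulus `A(x, d₁ + δ, (d₀ - δ)/2)` if well defined, and by the RSW estimate
(1.1) we have `P(⊞_{Q'}) ≤ Δ₁(d₁ + δ, (d₀ - δ)/2)`" (eq. (6.1)).  This file proves the deterministic
part of that sentence for the discrete configuration, in the vocabulary of the tree's RSW bound
(`annulusOpenCrossing`, `AnnulusCrossingBound.lean`; the perturbation size is called `ρ` here, the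
mesh `δ`):

* `exists_restrict_until_dist_ge` — a path from inside `B(x, R)` to its exterior, restricted up to
  its first exit, stays in `B̄(x, R)` and ends on the sphere (generic);
* `Quad.mem_annulusOpenCrossing_of_isCrossing_inner` — if `[Q'] ⊆ [Q]`, `∂₀Q' = ∂₀Q` and every point
  of `∂₂Q'` is joined to `∂₂Q` inside `[Q]` by a path of diameter `≤ ρ` (the parts of condition (2)
  that matter), `τ` is a path in `[Q]` from `∂₁Q` to `∂₃Q` of diameter `≤ D₁`, and
  `D₁ + ρ < R`, `2R < d₀(Q) - ρ`, then every crossing of `Q'` inside the open edges of `δℤ²` puts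
  `ω` in `annulusOpenCrossing (τ 0) δ (D₁ + ρ + δ) (R - δ)`.  Ingredients: crossings inside the open
  edges are path crossings (`joinedIn_inter_openEdgeUnion_of_isConnected`); the crossing lemma
  `Quad.exists_mem_of_isPreconnected_crossing` for the continuum "crossing ∪ short junction to
  `∂₂Q`" against `τ`; `d₀(Q) ≤ diam` of the concatenated path (`Quad.sideDist_le`); and the lattice
  shadow `mem_annulusOpenCrossing_of_path`.

## References

* O. Schramm, S. Smirnov, Ann. Probab. 39 (2011) 1768–1814, arXiv:1101.5820, proof of Lemma 6.1,
  case (2), eq. (6.1). [SchrammSmirnov2011]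
-/

noncomputable section

open scoped unitInterval
open Set Filter Metric Function
open _root_.Topology
open Literature.Probability.LatticeModels

namespace Literature.Probability.Percolation

namespace QuadCrossing

/-! ### First exit of a path from a ball -/

/-- **Restriction of a path up to its first exit from a ball.**  If `γ : [0,1] → ℂ` is continuous
with `dist (γ 0) x < R ≤ dist (γ 1) x`, then some continuous `γ' : [0,1] → ℂ` (an initial piece of
`γ`, linearly reparametrised) starts at `γ 0`, takes values in `γ([0,1])`, stays within `R` of `x`,
and ends at distance `≥ R` (indeed `= R`) from `x`. [folklore] -/
theorem exists_restrict_until_dist_ge {x : ℂ} {R : ℝ} {γ : ℝ → ℂ} (hγ : ContinuousOn γ (Icc 0 1))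
    (h0 : dist (γ 0) x < R) (h1 : R ≤ dist (γ 1) x) :
    ∃ γ' : ℝ → ℂ, ContinuousOn γ' (Icc 0 1) ∧ γ' 0 = γ 0 ∧ (∀ t ∈ Icc (0 : ℝ) 1, γ' t ∈ γ '' Icc 0 1) ∧
      (∀ t ∈ Icc (0 : ℝ) 1, dist (γ' t) x ≤ R) ∧ R ≤ dist (γ' 1) x := by
  set T : Set ℝ := {t | t ∈ Icc (0 : ℝ) 1 ∧ R ≤ dist (γ t) x} with hT
  have hTc : IsClosed T :=
    hγ.preimage_isClosed_of_isClosed isClosed_Icc (isClosed_le continuous_const (continuous_id.dist continuous_const))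
  have hTne : T.Nonempty := ⟨1, right_mem_Icc.2 zero_le_one, h1⟩
  have hTbdd : BddBelow T := ⟨0, fun t ht => ht.1.1⟩
  set τ := sInf T with hτ
  have hτT : τ ∈ T := hTc.csInf_mem hTne hTbdd
  have hτ0 : 0 < τ := by
    rcases hτT.1.1.eq_or_lt with h | h
    · exfalso
      have := hτT.2
      rw [← h] at this
      exact (lt_irrefl _ (h0.trans_le this))
    · exact h
  have hτ1 : τ ≤ 1 := hτT.1.2
  have hbefore : ∀ t ∈ Ico (0 : ℝ) τ, dist (γ t) x < R := fun t ht => by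
    by_contra h
    push Not at h
    have : t ∈ T := ⟨⟨ht.1, ht.2.le.trans hτ1⟩, h⟩
    exact lt_irrefl _ (ht.2.trans_le (csInf_le hTbdd this))
  -- at `τ` the distance is exactly `R`
  have hτle : dist (γ τ) x ≤ R := by
    have hcl : IsClosed {t | t ∈ Icc (0 : ℝ) 1 ∧ dist (γ t) x ≤ R} :=
      hγ.preimage_isClosed_of_isClosed isClosed_Icc
        (isClosed_le (continuous_id.dist continuous_const) continuous_const)
    have hsub : Ico (0 : ℝ) τ ⊆ {t | t ∈ Icc (0 : ℝ) 1 ∧ dist (γ t) x ≤ R} := fun t ht =>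
      ⟨⟨ht.1, ht.2.le.trans hτ1⟩, (hbefore t ht).le⟩
    have hτcl : τ ∈ closure (Ico (0 : ℝ) τ) := by
      rw [closure_Ico hτ0.ne]; exact right_mem_Icc.2 hτ0.le
    exact (hcl.closure_subset_iff.2 hsub hτcl).2
  -- the reparametrised initial piece
  refine ⟨fun s => γ (τ * s), ?_, by simp, fun t ht => ?_, fun t ht => ?_, by simpa using hτT.2⟩
  · refine hγ.comp (continuous_const.mul continuous_id).continuousOn fun s hs => ?_
    exact ⟨mul_nonneg hτ0.le hs.1, by nlinarith [hs.2, hτ1, hτ0]⟩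
  · exact ⟨τ * t, ⟨mul_nonneg hτ0.le ht.1, by nlinarith [ht.2, hτ1, hτ0]⟩, rfl⟩
  · show dist (γ (τ * t)) x ≤ R
    rcases ht.2.eq_or_lt with h | h
    · rw [h, mul_one]; exact hτle
    · exact (hbefore (τ * t) ⟨mul_nonneg hτ0.le ht.1, by nlinarith [hτ0]⟩).le

/-! ### The a-priori arm of case (2) -/

namespace Quad

variable {D : Set ℂ} {Q Q' : Quad D} {δ : ℝ} {ω : BondConfig (Site 2)}

/-- **A crossing of the inner quad crosses an annulus around the foot of any transversal** (the
deterministic half of eq. (6.1) in the proof of Schramm–Smirnov's Lemma 6.1, case (2)).  Let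
`[Q'] ⊆ [Q]`, `∂₀Q' = ∂₀Q`, and let every point of `∂₂Q'` be joined to `∂₂Q` by a path in `[Q]` of
diameter `≤ ρ` (`0 ≤ ρ`).  Let `τ` be a path in `[Q]` from `x₁ ∈ ∂₁Q` to `∂₃Q` with
`diam τ ≤ D₁`, and let `D₁ + ρ < R`, `2R < d₀(Q) - ρ`.  If `Q'` has a crossing inside the open edges
of `δℤ²` (`δ > 0`), then `ω ∈ annulusOpenCrossing x₁ δ (D₁ + ρ + δ) (R - δ)`: the crossing is a path
`p` in `[Q'] ∩` (open edges); `p` followed by the short junction `α` to `∂₂Q` joins `∂₀Q` to `∂₂Q`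
inside `[Q]`, hence meets `τ` (so `p` passes within `D₁ + ρ` of `x₁`) and has diameter `≥ d₀(Q)` (so
`p`, of diameter `> 2R`, leaves `B(x₁, R)`); the piece of `p` up to its first exit is shadowed by an
open lattice path. [cite: SchrammSmirnov2011, proof of Lemma 6.1, case (2), eq. (6.1)] -/
theorem mem_annulusOpenCrossing_of_isCrossing_inner (hδ : 0 < δ) {ρ : ℝ} (hρ : 0 ≤ ρ)
    (hcar : Q'.carrier ⊆ Q.carrier) (h0 : Q'.side 0 = Q.side 0)
    (hjoin : ∀ y ∈ Q'.side 2, Q.ShortJoin ρ y (Q.side 2))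
    {x₁ x₃ : ℂ} (hx₁ : x₁ ∈ Q.side 1) (hx₃ : x₃ ∈ Q.side 3) (τ : Path x₁ x₃)
    (hτ : range τ ⊆ Q.carrier) {D₁ : ℝ} (hD₁ : Metric.diam (range τ) ≤ D₁)
    {R : ℝ} (hDR : D₁ + ρ < R) (hR2 : 2 * R < Q.sideDist 0 - ρ)
    {K : Set ℂ} (hK : Q'.IsCrossing K) (hKO : K ⊆ openEdgeUnion δ ω) :
    ω ∈ annulusOpenCrossing x₁ δ (D₁ + ρ + δ) (R - δ) := by
  obtain ⟨hKc, hKconn, hKsub, ⟨a, haK, ha0⟩, ⟨y, hyK, hy2⟩⟩ := hK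
  -- the crossing as a path `p` inside `[Q'] ∩ O`
  obtain ⟨p, hp⟩ := joinedIn_inter_openEdgeUnion_of_isConnected hδ hKc hKconn hKO hKsub haK hyK
  -- the short junction `α` from `y ∈ ∂₂Q'` to `∂₂Q`
  obtain ⟨y₂, hy₂, α, hα, hαdiam⟩ := hjoin y hy2
  have ha : a ∈ Q.side 0 := h0 ▸ ha0
  have hpQ : range p ⊆ Q.carrier := by
    rintro _ ⟨t, rfl⟩
    exact hcar (hp t).1
  have hpO : range p ⊆ openEdgeUnion δ ω := by
    rintro _ ⟨t, rfl⟩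
    exact (hp t).2
  -- `p` passes within `D₁ + ρ` of `x₁`
  have hnear : ∃ u ∈ range p, dist u x₁ ≤ D₁ + ρ := by
    set L : Set ℂ := range p ∪ range α with hL
    have hLc : IsCompact L := (isCompact_range p.continuous).union (isCompact_range α.continuous)
    have hLconn : IsConnected L := by
      refine (isConnected_range p.continuous).union ⟨y, ⟨1, p.target⟩, ⟨0, α.source⟩⟩
        (isConnected_range α.continuous)
    have hLsub : L ⊆ Q.carrier := union_subset hpQ hα
    have hL0 : (L ∩ Q.side 0).Nonempty := ⟨a, Or.inl ⟨0, p.source⟩, ha⟩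
    have hL2 : (L ∩ Q.side 2).Nonempty := ⟨y₂, Or.inr ⟨1, α.target⟩, hy₂⟩
    obtain ⟨t, -, ht⟩ := Q.exists_mem_of_isPreconnected_crossing hLc hLconn.isPreconnected hLsub
      hL0 hL2 τ.continuous_extend.continuousOn (fun s _ => hτ (by
        exact ⟨projIcc 0 1 zero_le_one s, rfl⟩)) (by rw [τ.extend_zero]; exact hx₁)
      (by rw [τ.extend_one]; exact hx₃)
    have hwτ : τ.extend t ∈ range τ := ⟨projIcc 0 1 zero_le_one t, rfl⟩
    have hw : dist (τ.extend t) x₁ ≤ D₁ :=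
      (dist_le_diam_of_mem (isCompact_range τ.continuous).isBounded hwτ ⟨0, τ.source⟩).trans hD₁
    rcases ht with hmem | hmem
    · exact ⟨τ.extend t, hmem, by linarith⟩
    · refine ⟨y, ⟨1, p.target⟩, ?_⟩
      have hyw : dist y (τ.extend t) ≤ ρ :=
        (dist_le_diam_of_mem (isCompact_range α.continuous).isBounded ⟨0, α.source⟩ hmem).trans hαdiam
      linarith [dist_triangle y (τ.extend t) x₁]
  -- `p` has diameter `≥ d₀(Q) - ρ > 2R`, so it leaves `B(x₁, R)`
  have hdiam : Q.sideDist 0 - ρ ≤ Metric.diam (range p) := by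
    have h1 : Q.sideDist 0 ≤ Metric.diam (range (p.trans α)) :=
      Quad.sideDist_le (j := 0) ha hy₂ (p.trans α) (by rw [Path.trans_range]; exact union_subset hpQ hα)
    rw [Path.trans_range] at h1
    have h2 : Metric.diam (range p ∪ range α) ≤ Metric.diam (range p) + dist y y + Metric.diam (range α) :=
      Metric.diam_union ⟨1, p.target⟩ ⟨0, α.source⟩
    rw [dist_self, add_zero] at h2
    linarith
  have hD₁nn : (0 : ℝ) ≤ D₁ := Metric.diam_nonneg.trans hD₁
  have hfar : ∃ v ∈ range p, R ≤ dist v x₁ := by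
    by_contra hcon
    push Not at hcon
    have : Metric.diam (range p) ≤ 2 * R := by
      refine Metric.diam_le_of_forall_dist_le (by linarith) fun u hu v hv => ?_
      linarith [dist_triangle u x₁ v, hcon u hu, hcon v hv, dist_comm x₁ v]
    linarith
  obtain ⟨_, ⟨s₀, rfl⟩, hu⟩ := hnear
  obtain ⟨_, ⟨s₁, rfl⟩, hv⟩ := hfar
  -- the piece of `p` from `s₀` to `s₁`, up to its first exit from `B(x₁, R)`
  set γ : ℝ → ℂ := fun t => p.extend ((s₀ : ℝ) + t * ((s₁ : ℝ) - s₀)) with hγ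
  have hγc : Continuous γ := p.continuous_extend.comp (by fun_prop)
  have hγ0 : γ 0 = p s₀ := by simp [hγ]
  have hγ1 : γ 1 = p s₁ := by simp [hγ]
  have hγmem : ∀ t, γ t ∈ range p := fun t => ⟨projIcc 0 1 zero_le_one _, rfl⟩
  obtain ⟨γ', hγ'c, hγ'0, hγ'mem, hγ'R, hγ'1⟩ := exists_restrict_until_dist_ge (γ := γ) (x := x₁) (R := R)
    hγc.continuousOn (by rw [hγ0]; linarith) (by rw [hγ1]; exact hv)
  have hγ'p : ∀ t ∈ Icc (0 : ℝ) 1, γ' t ∈ range p := fun t ht => by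
    obtain ⟨s, -, hs⟩ := hγ'mem t ht
    rw [← hs]
    exact hγmem s
  have key := mem_annulusOpenCrossing_of_path hδ x₁ (r := D₁ + ρ) (R := R) hγ'c
    (fun t ht => hpO (hγ'p t ht)) (by rw [hγ'0, hγ0]; exact hu) hγ'R hγ'1
  simpa [add_assoc] using key

end Quad

end QuadCrossing

end Literature.Probability.Percolation
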